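import Mathlib
import HarnessLib
import Literature.Analysis.FluidPDE.NSBoundedMildOseenDuhamel
import Summits.NavierStokesRegularity.NavierStokesRegularity.Theorems.PoloidalWindowDoorPoloidalWindowRigidityDuhamelBump

/-!
# Route `PoloidalWindowDoor`, crux `PoloidalWindowRigidity` (K2, stmt-NavierStokesRegularity-19708) —
# LARGE-SCALE MOMENTUM CONSERVATION of bounded Oseen-mild fields

Cell ns-regularity-ideate, seat nsreg-p7 (gen 6, third worker under the K2 lead; `--supports stmt-…-19708`).
This is the `(M)`-content of the discharge of the K2 lead's hypothesis (F1) (`…LargeScaleEnergy`, `hBMO`).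
For a field `v` bounded by `M` on `(s,t) × ℝ³` and on its two continuous end slices, satisfying the KERNEL-FORM
Oseen identity `v(t) = e^{(t−s)Δ}v(s) − B¹_s(v,v)(t)` (the clause (M) of the route's Type-I class), and every
scalar test function `θ`, vector `e` and `R > 0`,

  `|∫ θ(x) ⟪v(t,x) − v(s,x), e⟫ dx| ≤ ‖e‖ (t − s) [ M ∫|Δθ| + M² ( ∫‖Dθ‖ + 2^{3/2}·2R ∫‖D²θ‖ + K_Θ (2/R) ∫|θ| ) ]`

(`abs_integral_mul_inner_sub_le`).  For the normalised bump `θ_R` of width `R` every term is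
`O((t − s)(M + M²)/R)`: **the mean velocity over large balls does not move in time**.  This is exactly what
fails for the parasitic drift `v = c(t)e₃`, `p = −c′(t)x₃` of the negative lane (`∫θ⟨v(t)−v(s),e₃⟩ = c(t)−c(s)`),
which satisfies every other clause of the class; the sibling files turn it into the vanishing of the affine
gauge of the class pressure (`…PressureGauge`) and then into (F1).

Proof: `∫θ⟪v(t)−v(s),e⟫ = ∫⟪e^{σΔ}v(s) − v(s), θe⟫ − ∫⟪B¹_s(v,v)(t), θe⟫` (`σ = t − s`).  The datum term is
`∫(e^{σΔ}θ − θ)⟪v(s),e⟫` (symmetry of the heat semigroup, `integral_inner_heatExtension_comm_of_bound`), bounded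
by `M‖e‖σ∫|Δθ|` (`…BumpRates.lintegral_enorm_heatExtension_sub_self_le`); the Duhamel term is
`…DuhamelBump.abs_integral_inner_oseenDuhamel_le`.

WHAT THIS IS NOT: not a claim about Navier–Stokes regularity and not the open residue S2⁗ — a whole-class
kinematic consequence of the Oseen-mild identity (bears_on LADDER-NS N0 via crux K2 = stmt-19708).
-/

noncomputable section

-- the summit and its single sub-problem share the name (CONVENTIONS §1), as in every Theorems file
set_option linter.dupNamespace false
-- nested operator types `ℝ³ →L[ℝ] ℝ³ →L[ℝ] ℝ`
set_option maxSynthPendingDepth 3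

namespace Summit.NavierStokesRegularity.NavierStokesRegularity.Theorems.PoloidalWindowDoorPoloidalWindowRigidityLargeScaleMomentum

open MeasureTheory Set Function Filter Topology Metric InnerProductSpace
open scoped RealInnerProductSpace ENNReal NNReal Laplacian ContDiff
open Literature.Analysis Literature.Analysis.FluidPDE Literature.Analysis.UnboundedOperators
open Summit.NavierStokesRegularity.NavierStokesRegularity.Theorems.PoloidalWindowDoorPoloidalWindowRigidityOseenBumpPairing
open Summit.NavierStokesRegularity.NavierStokesRegularity.Theorems.PoloidalWindowDoorPoloidalWindowRigidityBumpRates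
open Summit.NavierStokesRegularity.NavierStokesRegularity.Theorems.PoloidalWindowDoorPoloidalWindowRigidityDuhamelBump

/-! ## Large-scale momentum conservation -/

section Momentum

variable {v : ℝ → EuclideanSpace ℝ (Fin 3) → EuclideanSpace ℝ (Fin 3)} {s t M R : ℝ}
  {θ : EuclideanSpace ℝ (Fin 3) → ℝ}

/-- A bounded continuous field pairs integrably with a continuous compactly supported one. [folklore] -/
theorem integrable_inner_of_bound {f g : EuclideanSpace ℝ (Fin 3) → EuclideanSpace ℝ (Fin 3)}
    (hf : AEStronglyMeasurable f volume) {C : ℝ} (hC : ∀ x, ‖f x‖ ≤ C) (hg : Integrable g volume) :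
    Integrable (fun x => ⟪f x, g x⟫) volume := by
  refine Integrable.mono' (hg.norm.const_mul C) (hf.inner hg.aestronglyMeasurable)
    (Eventually.of_forall fun x => ?_)
  calc ‖⟪f x, g x⟫‖ ≤ ‖f x‖ * ‖g x‖ := norm_inner_le_norm _ _
    _ ≤ C * ‖g x‖ := mul_le_mul_of_nonneg_right (hC x) (norm_nonneg _)

/-- **The caloric datum term against a scalar bump:**
`|∫ ⟪e^{σΔ}(v s), θe⟫ − ∫ ⟪v s, θe⟫| ≤ M|e| σ ∫|Δθ|` for continuous `|v(s)| ≤ M`, `σ > 0` (symmetry of the heat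
semigroup and the caloric datum defect of `θ`). [folklore] -/
theorem abs_integral_inner_heatExtension_sub_le {σ : ℝ} (hσ : 0 < σ) (hM0 : 0 ≤ M)
    (hvs : Continuous (v s)) (hMs : ∀ y, ‖v s y‖ ≤ M)
    (hθ : FunctionSpaces.IsTestFunctionOn (⊤ : TopologicalSpace.Opens (EuclideanSpace ℝ (Fin 3))) θ)
    (e : EuclideanSpace ℝ (Fin 3)) :
    |(∫ x, ⟪heatExtension (v s) σ x, θ x • e⟫) - ∫ x, ⟪v s x, θ x • e⟫| ≤
      M * ‖e‖ * σ * ∫ x, ‖Δ θ x‖ := by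
  have hθ2 : ContDiff ℝ 2 θ := contDiff_infty.1 hθ.contDiff 2
  have hw : Continuous fun x => θ x • e := hθ.contDiff.continuous.smul continuous_const
  have hwc : HasCompactSupport fun x => θ x • e := hθ.hasCompactSupport.smul_right
  have hwi : Integrable (fun x => θ x • e) volume := hw.integrable_of_hasCompactSupport hwc
  have hΔc : Continuous (Δ θ) := FluidPDE.continuous_laplacian hθ2
  have hΔs : HasCompactSupport (Δ θ) := hθ.hasCompactSupport.mono' fun z hz => by
    contrapose! hz
    simp [FluidPDE.laplacian_eq_zero_of_notMem_tsupport hz]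
  have hΔi : Integrable (fun x => ‖Δ θ x‖) volume := hΔc.norm.integrable_of_hasCompactSupport hΔs.norm
  have hΔ0 : 0 ≤ ∫ x, ‖Δ θ x‖ := integral_nonneg fun x => norm_nonneg _
  rw [integral_inner_heatExtension_comm_of_bound hvs.aestronglyMeasurable hMs hw hwc hσ]
  have hHi : Integrable (heatExtension (fun x => θ x • e) σ) volume := integrable_heatExtension hwi hσ
  have hi1 : Integrable (fun x => ⟪v s x, heatExtension (fun x => θ x • e) σ x⟫) volume :=
    integrable_inner_of_bound hvs.aestronglyMeasurable hMs hHi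
  have hi2 : Integrable (fun x => ⟪v s x, θ x • e⟫) volume :=
    integrable_inner_of_bound hvs.aestronglyMeasurable hMs hwi
  rw [← integral_sub hi1 hi2]
  have hpt : ∀ x, ⟪v s x, heatExtension (fun x => θ x • e) σ x⟫ - ⟪v s x, θ x • e⟫ =
      (heatExtension θ σ x - θ x) * ⟪v s x, e⟫ := by
    intro x
    rw [← inner_sub_right, heatExtension_smul_const, ← sub_smul, real_inner_smul_right]
  simp_rw [hpt]
  -- bound through the Lebesgue integral
  have hle : ∫⁻ x, ENNReal.ofReal ‖(heatExtension θ σ x - θ x) * ⟪v s x, e⟫‖ ≤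
      ENNReal.ofReal (M * ‖e‖ * σ * ∫ x, ‖Δ θ x‖) := by
    have h1 : ∀ x, ENNReal.ofReal ‖(heatExtension θ σ x - θ x) * ⟪v s x, e⟫‖ ≤
        ENNReal.ofReal (M * ‖e‖) * ‖heatExtension θ σ x - θ x‖ₑ := by
      intro x
      rw [← ofReal_norm, ← ENNReal.ofReal_mul (by positivity)]
      refine ENNReal.ofReal_le_ofReal ?_
      rw [norm_mul]
      calc ‖heatExtension θ σ x - θ x‖ * ‖⟪v s x, e⟫‖
          ≤ ‖heatExtension θ σ x - θ x‖ * (‖v s x‖ * ‖e‖) :=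
            mul_le_mul_of_nonneg_left (norm_inner_le_norm _ _) (norm_nonneg _)
        _ ≤ ‖heatExtension θ σ x - θ x‖ * (M * ‖e‖) := by gcongr; exact hMs x
        _ = M * ‖e‖ * ‖heatExtension θ σ x - θ x‖ := by ring
    calc ∫⁻ x, ENNReal.ofReal ‖(heatExtension θ σ x - θ x) * ⟪v s x, e⟫‖
        ≤ ∫⁻ x, ENNReal.ofReal (M * ‖e‖) * ‖heatExtension θ σ x - θ x‖ₑ := lintegral_mono h1
      _ = ENNReal.ofReal (M * ‖e‖) * ∫⁻ x, ‖heatExtension θ σ x - θ x‖ₑ :=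
          lintegral_const_mul' _ _ ENNReal.ofReal_ne_top
      _ ≤ ENNReal.ofReal (M * ‖e‖) * (ENNReal.ofReal σ * ∫⁻ x, ‖Δ θ x‖ₑ) := by
          gcongr; exact lintegral_enorm_heatExtension_sub_self_le hθ hσ
      _ = ENNReal.ofReal (M * ‖e‖ * σ * ∫ x, ‖Δ θ x‖) := by
          have hD : ∫⁻ x, ‖Δ θ x‖ₑ = ENNReal.ofReal (∫ x, ‖Δ θ x‖) := by
            rw [ofReal_integral_eq_lintegral_ofReal hΔi (Eventually.of_forall fun x => norm_nonneg _)]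
            exact lintegral_congr fun x => (ofReal_norm _).symm
          rw [hD, ← ENNReal.ofReal_mul hσ.le, ← ENNReal.ofReal_mul (by positivity)]
          ring_nf
  calc |∫ x, (heatExtension θ σ x - θ x) * ⟪v s x, e⟫| = ‖∫ x, (heatExtension θ σ x - θ x) * ⟪v s x, e⟫‖ :=
        (Real.norm_eq_abs _).symm
    _ ≤ (∫⁻ x, ENNReal.ofReal ‖(heatExtension θ σ x - θ x) * ⟪v s x, e⟫‖).toReal :=
        norm_integral_le_lintegral_norm _
    _ ≤ M * ‖e‖ * σ * ∫ x, ‖Δ θ x‖ := ENNReal.toReal_le_of_le_ofReal (by positivity) hle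

/-- **LARGE-SCALE MOMENTUM CONSERVATION of bounded Oseen-mild fields.** Let `v` be measurable on
`(s,t) × ℝ³`, bounded by `M` there and on the two continuous end slices, and satisfy the kernel-form Oseen
identity `v(t) = e^{(t−s)Δ}v(s) − B¹_s(v,v)(t)` (clause (M) of the route's Type-I class). Then for every scalar
test function `θ`, vector `e` and `R > 0`,
`|∫ θ ⟪v(t) − v(s), e⟫| ≤ ‖e‖(t−s)[M ∫|Δθ| + M²(∫‖Dθ‖ + 2^{3/2}·2R ∫‖D²θ‖ + K_Θ(2/R)∫|θ|)]`.
For the drift `c(t)e₃` of the negative lane the left side is `|c(t) − c(s)| ∫θ` while the right side is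
`O(1/R)` for a normalised bump of width `R`: this is the clause that (M) adds. [folklore] -/
theorem abs_integral_mul_inner_sub_le (hst : s < t) (hM0 : 0 ≤ M) (hR : 0 < R)
    (hmeas : AEStronglyMeasurable (uncurry v)
      ((volume : Measure (ℝ × EuclideanSpace ℝ (Fin 3))).restrict (Ioo s t ×ˢ univ)))
    (hM : ∀ τ ∈ Ioo s t, ∀ y, ‖v τ y‖ ≤ M)
    (hvs : Continuous (v s)) (hvt : Continuous (v t)) (hMs : ∀ y, ‖v s y‖ ≤ M) (hMt : ∀ y, ‖v t y‖ ≤ M)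
    (hmild : ∀ x, v t x = heatExtension (v s) (t - s) x - oseenDuhamel 1 s v v t x)
    (hθ : FunctionSpaces.IsTestFunctionOn (⊤ : TopologicalSpace.Opens (EuclideanSpace ℝ (Fin 3))) θ)
    (e : EuclideanSpace ℝ (Fin 3)) :
    |∫ x, θ x * ⟪v t x - v s x, e⟫| ≤
      ‖e‖ * (t - s) * (M * (∫ x, ‖Δ θ x‖) + M ^ 2 * ((∫ x, ‖fderiv ℝ θ x‖) +
        (2 : ℝ) ^ ((Module.finrank ℝ (EuclideanSpace ℝ (Fin 3)) : ℝ) / 2) * (2 * R) *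
          (∫ x, ‖fderiv ℝ (fderiv ℝ θ) x‖) +
        ((3 / 2) * (2 : ℝ) ^ ((Module.finrank ℝ (EuclideanSpace ℝ (Fin 3)) : ℝ) / 2) +
          8 * 64 * ((2 : ℝ) ^ ((Module.finrank ℝ (EuclideanSpace ℝ (Fin 3)) : ℝ) / 2)) ^ 3) * (2 / R) *
          ∫ x, |θ x|)) := by
  have hσ : 0 < t - s := by linarith
  have hw : Continuous fun x => θ x • e := hθ.contDiff.continuous.smul continuous_const
  have hwc : HasCompactSupport fun x => θ x • e := hθ.hasCompactSupport.smul_right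
  have hwi : Integrable (fun x => θ x • e) volume := hw.integrable_of_hasCompactSupport hwc
  set H : EuclideanSpace ℝ (Fin 3) → EuclideanSpace ℝ (Fin 3) := heatExtension (v s) (t - s) with hH
  set B : EuclideanSpace ℝ (Fin 3) → EuclideanSpace ℝ (Fin 3) := oseenDuhamel 1 s v v t with hB
  have hHc : Continuous H := (contDiff_heatExtension_of_bound hvs hMs hσ (m := 0)).continuous
  have hHM : ∀ x, ‖H x‖ ≤ M := fun x => norm_heatExtension_le hMs hσ x
  have hBeq : ∀ x, B x = H x - v t x := fun x => by rw [hmild x]; abel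
  have hBc : Continuous B := by
    rw [show B = fun x => H x - v t x from funext hBeq]; exact hHc.sub hvt
  have hBM : ∀ x, ‖B x‖ ≤ M + M := fun x => by
    rw [hBeq]; exact (norm_sub_le _ _).trans (add_le_add (hHM x) (hMt x))
  -- integrability of the four pairings
  have hit : Integrable (fun x => ⟪v t x, θ x • e⟫) volume :=
    integrable_inner_of_bound hvt.aestronglyMeasurable hMt hwi
  have his : Integrable (fun x => ⟪v s x, θ x • e⟫) volume :=
    integrable_inner_of_bound hvs.aestronglyMeasurable hMs hwi
  have hiH : Integrable (fun x => ⟪H x, θ x • e⟫) volume :=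
    integrable_inner_of_bound hHc.aestronglyMeasurable hHM hwi
  have hiB : Integrable (fun x => ⟪B x, θ x • e⟫) volume :=
    integrable_inner_of_bound hBc.aestronglyMeasurable hBM hwi
  -- the algebra
  have h1 : ∫ x, θ x * ⟪v t x - v s x, e⟫ =
      ((∫ x, ⟪H x, θ x • e⟫) - ∫ x, ⟪v s x, θ x • e⟫) - ∫ x, ⟪B x, θ x • e⟫ := by
    have hpt : ∀ x, θ x * ⟪v t x - v s x, e⟫ = (⟪H x, θ x • e⟫ - ⟪v s x, θ x • e⟫) - ⟪B x, θ x • e⟫ := by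
      intro x
      rw [hmild x, real_inner_smul_right, real_inner_smul_right, real_inner_smul_right, inner_sub_left,
        inner_sub_left]
      ring
    have hi12 : Integrable (fun x => ⟪H x, θ x • e⟫ - ⟪v s x, θ x • e⟫) volume := hiH.sub his
    simp_rw [hpt]
    rw [integral_sub hi12 hiB, integral_sub hiH his]
  rw [h1]
  have hdatum := abs_integral_inner_heatExtension_sub_le (v := v) hσ hM0 hvs hMs hθ e
  have hduh := abs_integral_inner_oseenDuhamel_le hst hM0 hR hmeas hM hθ e
  have hts : 0 ≤ t - s := hσ.le
  calc |((∫ x, ⟪H x, θ x • e⟫) - ∫ x, ⟪v s x, θ x • e⟫) - ∫ x, ⟪B x, θ x • e⟫|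
      ≤ |(∫ x, ⟪H x, θ x • e⟫) - ∫ x, ⟪v s x, θ x • e⟫| + |∫ x, ⟪B x, θ x • e⟫| := abs_sub _ _
    _ ≤ M * ‖e‖ * (t - s) * (∫ x, ‖Δ θ x‖) +
        M ^ 2 * ‖e‖ * (t - s) * ((∫ x, ‖fderiv ℝ θ x‖) +
          (2 : ℝ) ^ ((Module.finrank ℝ (EuclideanSpace ℝ (Fin 3)) : ℝ) / 2) * (2 * R) *
            (∫ x, ‖fderiv ℝ (fderiv ℝ θ) x‖) +
          ((3 / 2) * (2 : ℝ) ^ ((Module.finrank ℝ (EuclideanSpace ℝ (Fin 3)) : ℝ) / 2) +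
            8 * 64 * ((2 : ℝ) ^ ((Module.finrank ℝ (EuclideanSpace ℝ (Fin 3)) : ℝ) / 2)) ^ 3) * (2 / R) *
            ∫ x, |θ x|) := add_le_add hdatum hduh
    _ = _ := by ring

end Momentum

end Summit.NavierStokesRegularity.NavierStokesRegularity.Theorems.PoloidalWindowDoorPoloidalWindowRigidityLargeScaleMomentum

end
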